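import Summits.AtomisticToContinuum.FouriersLaw.Theorems.ContactStieltjesMeasureStieltjesRepresentationPencilIBP
import Summits.AtomisticToContinuum.FouriersLaw.Theorems.HonestZwanzigOrthogonalOhmDirichletBound
import Summits.AtomisticToContinuum.FouriersLaw.Theorems.OddSectorIrreversibilityOddDensityIsCorrectorAdjoint

/-!
# Stub `stub_pencilOfGreenKubo` of line `cayley-pencil` (crux `ContactStieltjesMeasure.StieltjesRepresentation`,
# stmt-AtomisticToContinuum-15248), part 5a: the energy identities (E₀), (E₀') in Gibbs-weighted form

Helper file (`--supports stmt-AtomisticToContinuum-15248`). Pinned anharmonic chain `P_γ = pinnedChain ω₂ lam β γ`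
(`ω₂ > 0`, `lam, β ≥ 0`), `N ≥ 2`, both baths at `T > 0`, `ρ = e^{-H/T}`, bath sites `b ∈ {0, N-1}`, `D = √T(∂_{p_0}, ∂_{p_{N-1}})`.
A NICE FIELD is a pair `F = (F₀, F₁)` of smooth functions with `|F_b|, |∂_{p_0}F_b|, |∂_{p_{N-1}}F_b| ≤ A e^{H/(16T)}`; its
ADJOINT FIELD (Gibbs divergence) is `v_F = D*F = √T Σ_b (-∂_{p_b}F_b + p_b F_b/T)`, a smooth centred observable
`O(e^{H/(8T)})` (`adjointField_nice`). For Poisson-class functions `w` (smooth, `O(e^{H/(8T)})`) solving `L_γ w = -v_F`,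
resp. the ADJOINT problem `L_γ† w' = -v_F` (`L_γ† k = (L_γ(k∘Θ))∘Θ`, solved by `w' = w̃∘Θ` with `L_γ w̃ = -(v_F∘Θ)`):

* `energy_identity` — (E₀) `Σ_b ∫ F_b (√T∂_bw) ρ = γ Σ_b ∫ (√T∂_bw)² ρ` and `(∂_bw)²ρ ∈ L¹` (Gibbs integration by parts of
  part 2 + the exact Dirichlet identity: ALL entropy is produced at the contacts);
* `energy_identity_adjoint` — (E₀') the same for the adjoint solution `w' = w̃∘Θ` (transport by the momentum flip);
Part 5b adds (A₀) adjointness and (C₀) the cross-friction identity; together these are the hypotheses of the abstract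
extension lemma of part 1, up to the normalisation `Z⁻¹`. No definitions.
-/

noncomputable section

open MeasureTheory Filter Topology Set Function
open scoped ContDiff
open Literature.MathematicalPhysics.KineticTheory.HeatConduction

namespace Summit.AtomisticToContinuum.FouriersLaw.Theorems.ContactStieltjesMeasure.CayleyPencil

namespace Pencil

open Summit.AtomisticToContinuum.FouriersLaw.Theorems.OddSectorIrreversibility (partialP_comp_reversal)
open Summit.AtomisticToContinuum.FouriersLaw.Theorems.HonestZwanzig.OrthogonalOhmLine.DirichletBound
  (integrable_weights integrable_sq_partialP_mul_gibbsDensity dirichlet_identity)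

variable {N : ℕ}

section Pinned

variable {ω₂ lam β : ℝ} (hω : 0 < ω₂) (hl : 0 ≤ lam) (hβ : 0 ≤ β) (hN : 2 ≤ N) {T : ℝ} (hT : 0 < T)
include hω hl hβ hN hT

/-! ### The adjoint field of a nice field -/

/-- **The adjoint field `v_F = √T Σ_b (-∂_{p_b}F_b + p_bF_b/T)` of a nice field is a smooth centred nice observable**:
`v_F ∈ C^∞`, `|v_F| ≤ A' e^{H/(8T)}` with `A' ≥ 0`, `∫ v_F ρ = 0`, and the same for `v_F∘Θ`. [folklore] -/
theorem adjointField_nice (γ : ℝ) {F₀ F₁ v : PhaseSpace N → ℝ} (hF₀ : ContDiff ℝ ∞ F₀) (hF₁ : ContDiff ℝ ∞ F₁)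
    {A : ℝ} (hA : 0 ≤ A)
    (hb : ∀ y, |F₀ y| ≤ A * Real.exp ((pinnedChain ω₂ lam β γ).hamiltonian N y / (16 * T)) ∧
      |partialP ⟨0, by omega⟩ F₀ y| ≤ A * Real.exp ((pinnedChain ω₂ lam β γ).hamiltonian N y / (16 * T)) ∧
      |F₁ y| ≤ A * Real.exp ((pinnedChain ω₂ lam β γ).hamiltonian N y / (16 * T)) ∧
      |partialP ⟨N - 1, by omega⟩ F₁ y| ≤ A * Real.exp ((pinnedChain ω₂ lam β γ).hamiltonian N y / (16 * T)))
    (hv : ∀ x, v x = Real.sqrt T * (-partialP ⟨0, by omega⟩ F₀ x + x.2 ⟨0, by omega⟩ * F₀ x / T) +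
      Real.sqrt T * (-partialP ⟨N - 1, by omega⟩ F₁ x + x.2 ⟨N - 1, by omega⟩ * F₁ x / T)) :
    ContDiff ℝ ∞ v ∧ ContDiff ℝ ∞ (fun x : PhaseSpace N => v (x.1, -x.2)) ∧
    (∃ A' : ℝ, 0 ≤ A' ∧ (∀ y, |v y| ≤ A' * Real.exp ((pinnedChain ω₂ lam β γ).hamiltonian N y / (8 * T))) ∧
      ∀ y : PhaseSpace N, |v (y.1, -y.2)| ≤ A' * Real.exp ((pinnedChain ω₂ lam β γ).hamiltonian N y / (8 * T))) ∧
    ∫ x, v x * (pinnedChain ω₂ lam β γ).gibbsDensity N T x = 0 ∧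
    ∫ x, v (x.1, -x.2) * (pinnedChain ω₂ lam β γ).gibbsDensity N T x = 0 := by
  set P := pinnedChain ω₂ lam β γ with hP
  set b₀ : Fin N := ⟨0, by omega⟩ with hb₀
  set b₁ : Fin N := ⟨N - 1, by omega⟩ with hb₁
  have hvf : v = fun x => Real.sqrt T * (-partialP b₀ F₀ x + x.2 b₀ * F₀ x / T) +
      Real.sqrt T * (-partialP b₁ F₁ x + x.2 b₁ * F₁ x / T) := funext hv
  -- smoothness
  have hd₀ : ContDiff ℝ ∞ (partialP b₀ F₀) := contDiff_partialP hF₀ (by norm_cast) b₀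
  have hd₁ : ContDiff ℝ ∞ (partialP b₁ F₁) := contDiff_partialP hF₁ (by norm_cast) b₁
  have hp : ∀ i : Fin N, ContDiff ℝ ∞ fun x : PhaseSpace N => x.2 i := fun i =>
    (contDiff_apply ℝ ℝ i).comp contDiff_snd
  have hvs : ContDiff ℝ ∞ v := by
    rw [hvf]
    exact (contDiff_const.mul (hd₀.neg.add (((hp b₀).mul hF₀).div_const T))).add
      (contDiff_const.mul (hd₁.neg.add (((hp b₁).mul hF₁).div_const T)))
  have hΘ : ContDiff ℝ ∞ fun x : PhaseSpace N => ((x.1, -x.2) : PhaseSpace N) :=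
    contDiff_fst.prodMk contDiff_snd.neg
  -- centred
  have hc : ∫ x, v x * P.gibbsDensity N T x = 0 := by
    obtain ⟨i₀, e₀⟩ := integral_adjointP_mul_gibbsDensity_eq_zero hω hl hβ hT b₀ hF₀ hA (fun y => (hb y).1)
      (fun y => (hb y).2.1)
    obtain ⟨i₁, e₁⟩ := integral_adjointP_mul_gibbsDensity_eq_zero hω hl hβ hT b₁ hF₁ hA (fun y => (hb y).2.2.1)
      (fun y => (hb y).2.2.2)
    have e : ∀ x, v x * P.gibbsDensity N T x =
        Real.sqrt T * ((-partialP b₀ F₀ x + x.2 b₀ * F₀ x / T) * P.gibbsDensity N T x) +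
        Real.sqrt T * ((-partialP b₁ F₁ x + x.2 b₁ * F₁ x / T) * P.gibbsDensity N T x) := fun x => by
      rw [hv x]; ring
    simp_rw [e]
    rw [integral_add (i₀.const_mul _) (i₁.const_mul _), integral_const_mul, integral_const_mul, e₀, e₁]
    ring
  refine ⟨hvs, hvs.comp hΘ, ?_, hc, ?_⟩
  · -- the bound
    have h₀ := abs_adjointP_le hω hl hβ γ hT b₀ hA (fun y => (hb y).1) (fun y => (hb y).2.1)
    have h₁ := abs_adjointP_le hω hl hβ γ hT b₁ hA (fun y => (hb y).2.2.1) (fun y => (hb y).2.2.2)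
    set A' : ℝ := Real.sqrt T * A * (1 + (1 + 16 * T) / T) with hA'
    have hA'0 : 0 ≤ A' := by positivity
    have hvb : ∀ y, |v y| ≤ (A' + A') * Real.exp (P.hamiltonian N y / (8 * T)) := fun y => by
      rw [hv y, add_mul]
      exact (abs_add_le _ _).trans (add_le_add (h₀ y) (h₁ y))
    refine ⟨A' + A', by positivity, hvb, fun y => ?_⟩
    have h := hvb (y.1, -y.2)
    rwa [OscillatorChain.hamiltonian_neg_momentum] at h
  · -- centred after the flip (`ρ` is even, Lebesgue measure is flip-invariant)
    have h := integral_comp_momentumReversal N (fun x => v x * P.gibbsDensity N T x)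
    rw [← hc, ← h]
    refine integral_congr_ae (Eventually.of_forall fun x => ?_)
    simp only [OscillatorChain.gibbsDensity, OscillatorChain.hamiltonian_neg_momentum]

/-! ### (E₀): the energy identity of the forward Poisson solution -/

/-- **(E₀)** For a nice field `F`, its adjoint field `v`, and a smooth `w = O(e^{H/(8T)})` with `L_γ w = -v` (`γ > 0`):
`(∂_{p_b}w)²ρ ∈ L¹` at both bath sites and `Σ_b ∫ F_b·(√T ∂_{p_b}w) ρ = γ Σ_b ∫ (√T ∂_{p_b}w)² ρ`. [folklore] -/
theorem energy_identity {γ : ℝ} (hγ : 0 < γ) {F₀ F₁ v w : PhaseSpace N → ℝ} (hF₀ : ContDiff ℝ ∞ F₀)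
    (hF₁ : ContDiff ℝ ∞ F₁) {A : ℝ} (hA : 0 ≤ A)
    (hb : ∀ y, |F₀ y| ≤ A * Real.exp ((pinnedChain ω₂ lam β γ).hamiltonian N y / (16 * T)) ∧
      |partialP ⟨0, by omega⟩ F₀ y| ≤ A * Real.exp ((pinnedChain ω₂ lam β γ).hamiltonian N y / (16 * T)) ∧
      |F₁ y| ≤ A * Real.exp ((pinnedChain ω₂ lam β γ).hamiltonian N y / (16 * T)) ∧
      |partialP ⟨N - 1, by omega⟩ F₁ y| ≤ A * Real.exp ((pinnedChain ω₂ lam β γ).hamiltonian N y / (16 * T)))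
    (hv : ∀ x, v x = Real.sqrt T * (-partialP ⟨0, by omega⟩ F₀ x + x.2 ⟨0, by omega⟩ * F₀ x / T) +
      Real.sqrt T * (-partialP ⟨N - 1, by omega⟩ F₁ x + x.2 ⟨N - 1, by omega⟩ * F₁ x / T))
    (hw : ContDiff ℝ ∞ w) {K : ℝ}
    (hwb : ∀ y, |w y| ≤ K * Real.exp ((pinnedChain ω₂ lam β γ).hamiltonian N y / (8 * T)))
    (hLw : ∀ x, (pinnedChain ω₂ lam β γ).generator N T T w x = -v x) :
    Integrable (fun x => (partialP ⟨0, by omega⟩ w x) ^ 2 * (pinnedChain ω₂ lam β γ).gibbsDensity N T x) ∧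
    Integrable (fun x => (partialP ⟨N - 1, by omega⟩ w x) ^ 2 * (pinnedChain ω₂ lam β γ).gibbsDensity N T x) ∧
    (∫ x, F₀ x * (Real.sqrt T * partialP ⟨0, by omega⟩ w x) * (pinnedChain ω₂ lam β γ).gibbsDensity N T x) +
        ∫ x, F₁ x * (Real.sqrt T * partialP ⟨N - 1, by omega⟩ w x) * (pinnedChain ω₂ lam β γ).gibbsDensity N T x =
      γ * ((∫ x, (Real.sqrt T * partialP ⟨0, by omega⟩ w x) ^ 2 * (pinnedChain ω₂ lam β γ).gibbsDensity N T x) +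
        ∫ x, (Real.sqrt T * partialP ⟨N - 1, by omega⟩ w x) ^ 2 * (pinnedChain ω₂ lam β γ).gibbsDensity N T x) := by
  set P := pinnedChain ω₂ lam β γ with hP
  set ρ := P.gibbsDensity N T with hρ
  set b₀ : Fin N := ⟨0, by omega⟩ with hb₀
  set b₁ : Fin N := ⟨N - 1, by omega⟩ with hb₁
  obtain ⟨hvs, -, ⟨A', hA'0, hvb, -⟩, -, -⟩ := adjointField_nice hω hl hβ hN hT γ hF₀ hF₁ hA hb hv
  -- the Dirichlet identity (tree) and the finiteness of the bath Dirichlet forms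
  obtain ⟨hgw, hpw⟩ := integrable_weights (N := N) (γ := γ) (w := w) (g := v) hω hl hβ hT hw.continuous
    hvs.continuous hwb hvb
  have hw2 : ContDiff ℝ 2 w := hw.of_le (by norm_cast)
  obtain ⟨hD₀, hD₁⟩ := integrable_sq_partialP_mul_gibbsDensity hω hl hβ hN hT hγ hw2 hvs.continuous hLw hgw hpw
  have hdir := dirichlet_identity hω hl hβ hN hT hγ hw2 hvs.continuous hLw hgw hpw
  -- Gibbs integration by parts at both bath sites
  obtain ⟨-, -, e₀⟩ := integral_mul_partialP_mul_gibbsDensity_nice hω hl hβ hT b₀ hF₀ hw hA (fun y => (hb y).1)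
    (fun y => (hb y).2.1) hwb hD₀
  obtain ⟨-, j₁, e₁⟩ := integral_mul_partialP_mul_gibbsDensity_nice hω hl hβ hT b₁ hF₁ hw hA (fun y => (hb y).2.2.1)
    (fun y => (hb y).2.2.2) hwb hD₁
  obtain ⟨-, j₀, -⟩ := integral_mul_partialP_mul_gibbsDensity_nice hω hl hβ hT b₀ hF₀ hw hA (fun y => (hb y).1)
    (fun y => (hb y).2.1) hwb hD₀
  refine ⟨hD₀, hD₁, ?_⟩
  -- `Σ_b √T ∫ F_b ∂_b w ρ = ∫ v w ρ`
  have hsum : (∫ x, F₀ x * (Real.sqrt T * partialP b₀ w x) * ρ x) + ∫ x, F₁ x * (Real.sqrt T * partialP b₁ w x) * ρ x =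
      ∫ x, v x * w x * ρ x := by
    have e : ∀ x, v x * w x * ρ x = Real.sqrt T * ((-partialP b₀ F₀ x + x.2 b₀ * F₀ x / T) * w x * ρ x) +
        Real.sqrt T * ((-partialP b₁ F₁ x + x.2 b₁ * F₁ x / T) * w x * ρ x) := fun x => by rw [hv x]; ring
    simp_rw [e]
    rw [integral_add (j₀.const_mul _) (j₁.const_mul _), integral_const_mul, integral_const_mul, ← e₀, ← e₁,
      ← integral_const_mul, ← integral_const_mul]
    congr 1 <;> exact integral_congr_ae (Eventually.of_forall fun x => by ring)
  rw [hsum]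
  -- `∫ v w ρ = γT Σ_b ∫ (∂_b w)² ρ`
  have hvw : ∫ x, v x * w x * ρ x = γ * T * ((∫ x, (partialP b₀ w x) ^ 2 * ρ x) + ∫ x, (partialP b₁ w x) ^ 2 * ρ x) :=
    hdir.symm
  rw [hvw]
  have hsq : ∀ b, ∫ x, (Real.sqrt T * partialP b w x) ^ 2 * ρ x = T * ∫ x, (partialP b w x) ^ 2 * ρ x := by
    intro b
    rw [← integral_const_mul]
    refine integral_congr_ae (Eventually.of_forall fun x => ?_)
    have : Real.sqrt T ^ 2 = T := Real.sq_sqrt hT.le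
    calc (Real.sqrt T * partialP b w x) ^ 2 * ρ x = Real.sqrt T ^ 2 * ((partialP b w x) ^ 2 * ρ x) := by ring
      _ = T * ((partialP b w x) ^ 2 * ρ x) := by rw [this]
  rw [hsq b₀, hsq b₁]
  ring

/-! ### (E₀'): the energy identity of the adjoint Poisson solution -/

/-- **(E₀')** For a nice field `F` with adjoint field `v` and a smooth `w̃ = O(e^{H/(8T)})` with `L_γ w̃ = -(v∘Θ)` (`γ > 0`),
the flipped function `w' = w̃∘Θ` is smooth, `O(e^{H/(8T)})`, solves the ADJOINT Poisson problem `(L_γ(w'∘Θ))∘Θ = -v`, has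
`(∂_{p_b}w')²ρ ∈ L¹`, and `Σ_b ∫ F_b·(√T∂_{p_b}w') ρ = γ Σ_b ∫ (√T∂_{p_b}w')² ρ`. [folklore] -/
theorem energy_identity_adjoint {γ : ℝ} (hγ : 0 < γ) {F₀ F₁ v wt : PhaseSpace N → ℝ} (hF₀ : ContDiff ℝ ∞ F₀)
    (hF₁ : ContDiff ℝ ∞ F₁) {A : ℝ} (hA : 0 ≤ A)
    (hb : ∀ y, |F₀ y| ≤ A * Real.exp ((pinnedChain ω₂ lam β γ).hamiltonian N y / (16 * T)) ∧
      |partialP ⟨0, by omega⟩ F₀ y| ≤ A * Real.exp ((pinnedChain ω₂ lam β γ).hamiltonian N y / (16 * T)) ∧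
      |F₁ y| ≤ A * Real.exp ((pinnedChain ω₂ lam β γ).hamiltonian N y / (16 * T)) ∧
      |partialP ⟨N - 1, by omega⟩ F₁ y| ≤ A * Real.exp ((pinnedChain ω₂ lam β γ).hamiltonian N y / (16 * T)))
    (hv : ∀ x, v x = Real.sqrt T * (-partialP ⟨0, by omega⟩ F₀ x + x.2 ⟨0, by omega⟩ * F₀ x / T) +
      Real.sqrt T * (-partialP ⟨N - 1, by omega⟩ F₁ x + x.2 ⟨N - 1, by omega⟩ * F₁ x / T))
    (hwt : ContDiff ℝ ∞ wt) {K : ℝ}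
    (hwtb : ∀ y, |wt y| ≤ K * Real.exp ((pinnedChain ω₂ lam β γ).hamiltonian N y / (8 * T)))
    (hLwt : ∀ x, (pinnedChain ω₂ lam β γ).generator N T T wt x = -v (x.1, -x.2)) :
    ContDiff ℝ ∞ (fun x : PhaseSpace N => wt (x.1, -x.2)) ∧
    (∀ y : PhaseSpace N, |wt (y.1, -y.2)| ≤ K * Real.exp ((pinnedChain ω₂ lam β γ).hamiltonian N y / (8 * T))) ∧
    (∀ x : PhaseSpace N, (pinnedChain ω₂ lam β γ).generator N T T
      (fun y : PhaseSpace N => (fun z : PhaseSpace N => wt (z.1, -z.2)) (y.1, -y.2)) (x.1, -x.2) = -v x) ∧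
    Integrable (fun x => (partialP ⟨0, by omega⟩ (fun y : PhaseSpace N => wt (y.1, -y.2)) x) ^ 2 *
      (pinnedChain ω₂ lam β γ).gibbsDensity N T x) ∧
    Integrable (fun x => (partialP ⟨N - 1, by omega⟩ (fun y : PhaseSpace N => wt (y.1, -y.2)) x) ^ 2 *
      (pinnedChain ω₂ lam β γ).gibbsDensity N T x) ∧
    (∫ x, F₀ x * (Real.sqrt T * partialP ⟨0, by omega⟩ (fun y : PhaseSpace N => wt (y.1, -y.2)) x) *
        (pinnedChain ω₂ lam β γ).gibbsDensity N T x) +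
        ∫ x, F₁ x * (Real.sqrt T * partialP ⟨N - 1, by omega⟩ (fun y : PhaseSpace N => wt (y.1, -y.2)) x) *
          (pinnedChain ω₂ lam β γ).gibbsDensity N T x =
      γ * ((∫ x, (Real.sqrt T * partialP ⟨0, by omega⟩ (fun y : PhaseSpace N => wt (y.1, -y.2)) x) ^ 2 *
          (pinnedChain ω₂ lam β γ).gibbsDensity N T x) +
        ∫ x, (Real.sqrt T * partialP ⟨N - 1, by omega⟩ (fun y : PhaseSpace N => wt (y.1, -y.2)) x) ^ 2 *
          (pinnedChain ω₂ lam β γ).gibbsDensity N T x) := by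
  set P := pinnedChain ω₂ lam β γ with hP
  set ρ := P.gibbsDensity N T with hρ
  set b₀ : Fin N := ⟨0, by omega⟩ with hb₀
  set b₁ : Fin N := ⟨N - 1, by omega⟩ with hb₁
  set w' : PhaseSpace N → ℝ := fun x => wt (x.1, -x.2) with hw'
  obtain ⟨hvs, hvΘs, ⟨A', hA'0, hvb, hvΘb⟩, -, -⟩ := adjointField_nice hω hl hβ hN hT γ hF₀ hF₁ hA hb hv
  have hΘ : ContDiff ℝ ∞ fun x : PhaseSpace N => ((x.1, -x.2) : PhaseSpace N) := contDiff_fst.prodMk contDiff_snd.neg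
  have hw's : ContDiff ℝ ∞ w' := hwt.comp hΘ
  have hw'b : ∀ y : PhaseSpace N, |w' y| ≤ K * Real.exp (P.hamiltonian N y / (8 * T)) := fun y => by
    have h := hwtb (y.1, -y.2)
    rwa [OscillatorChain.hamiltonian_neg_momentum] at h
  have hflip : ∀ x : PhaseSpace N, (fun y : PhaseSpace N => w' (y.1, -y.2)) = wt := by
    intro x; funext y; simp [hw']
  have hadjeq : ∀ x : PhaseSpace N, P.generator N T T (fun y : PhaseSpace N => w' (y.1, -y.2)) (x.1, -x.2) = -v x := by
    intro x
    rw [hflip x, hLwt]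
    simp
  -- Dirichlet for `wt` (source `v∘Θ`), transported by the flip
  obtain ⟨hgw, hpw⟩ := integrable_weights (N := N) (γ := γ) (w := wt) (g := fun x => v (x.1, -x.2)) hω hl hβ hT
    hwt.continuous hvΘs.continuous hwtb hvΘb
  have hwt2 : ContDiff ℝ 2 wt := hwt.of_le (by norm_cast)
  obtain ⟨hDt₀, hDt₁⟩ := integrable_sq_partialP_mul_gibbsDensity hω hl hβ hN hT hγ hwt2 hvΘs.continuous hLwt hgw hpw
  have hdirt := dirichlet_identity hω hl hβ hN hT hγ hwt2 hvΘs.continuous hLwt hgw hpw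
  -- `∂_b w' = -(∂_b wt)∘Θ`, so the squares are flips of each other
  have hdw' : ∀ b x, partialP b w' x = -partialP b wt (x.1, -x.2) := fun b x => partialP_comp_reversal b wt x
  have hsqflip : ∀ b, Integrable (fun x => (partialP b wt x) ^ 2 * ρ x) →
      Integrable (fun x => (partialP b w' x) ^ 2 * ρ x) ∧
        ∫ x, (partialP b w' x) ^ 2 * ρ x = ∫ x, (partialP b wt x) ^ 2 * ρ x := by
    intro b hI
    have e : (fun x => (partialP b w' x) ^ 2 * ρ x) = fun x => (fun z => (partialP b wt z) ^ 2 * ρ z) (x.1, -x.2) := by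
      funext x
      simp only [hdw' b x, hρ, OscillatorChain.gibbsDensity, OscillatorChain.hamiltonian_neg_momentum]
      ring
    rw [e]
    refine ⟨?_, integral_comp_momentumReversal N (fun z => (partialP b wt z) ^ 2 * ρ z)⟩
    exact (measurePreserving_momentumReversal N).integrable_comp_emb (momentumReversal N).measurableEmbedding |>.2 hI
  obtain ⟨hD'₀, hI₀⟩ := hsqflip b₀ hDt₀
  obtain ⟨hD'₁, hI₁⟩ := hsqflip b₁ hDt₁
  refine ⟨hw's, hw'b, hadjeq, hD'₀, hD'₁, ?_⟩
  -- Gibbs integration by parts at both bath sites (against `w'`)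
  obtain ⟨-, j₀, e₀⟩ := integral_mul_partialP_mul_gibbsDensity_nice hω hl hβ hT b₀ hF₀ hw's hA (fun y => (hb y).1)
    (fun y => (hb y).2.1) hw'b hD'₀
  obtain ⟨-, j₁, e₁⟩ := integral_mul_partialP_mul_gibbsDensity_nice hω hl hβ hT b₁ hF₁ hw's hA (fun y => (hb y).2.2.1)
    (fun y => (hb y).2.2.2) hw'b hD'₁
  have hsum : (∫ x, F₀ x * (Real.sqrt T * partialP b₀ w' x) * ρ x) + ∫ x, F₁ x * (Real.sqrt T * partialP b₁ w' x) * ρ x =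
      ∫ x, v x * w' x * ρ x := by
    have e : ∀ x, v x * w' x * ρ x = Real.sqrt T * ((-partialP b₀ F₀ x + x.2 b₀ * F₀ x / T) * w' x * ρ x) +
        Real.sqrt T * ((-partialP b₁ F₁ x + x.2 b₁ * F₁ x / T) * w' x * ρ x) := fun x => by rw [hv x]; ring
    simp_rw [e]
    rw [integral_add (j₀.const_mul _) (j₁.const_mul _), integral_const_mul, integral_const_mul, ← e₀, ← e₁,
      ← integral_const_mul, ← integral_const_mul]
    congr 1 <;> exact integral_congr_ae (Eventually.of_forall fun x => by ring)
  rw [hsum]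
  -- `∫ v w' ρ = ∫ (v∘Θ) wt ρ = γT Σ_b ∫ (∂_b wt)² ρ = γT Σ_b ∫ (∂_b w')² ρ`
  have hvw : ∫ x, v x * w' x * ρ x = ∫ x, v (x.1, -x.2) * wt x * ρ x := by
    have h := integral_comp_momentumReversal N (fun x => v (x.1, -x.2) * wt x * ρ x)
    rw [← h]
    refine integral_congr_ae (Eventually.of_forall fun x => ?_)
    simp only [hw', hρ, OscillatorChain.gibbsDensity, OscillatorChain.hamiltonian_neg_momentum, neg_neg, Prod.mk.eta]
  rw [hvw, ← hdirt, ← hI₀, ← hI₁]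
  have hsq : ∀ b, ∫ x, (Real.sqrt T * partialP b w' x) ^ 2 * ρ x = T * ∫ x, (partialP b w' x) ^ 2 * ρ x := by
    intro b
    rw [← integral_const_mul]
    refine integral_congr_ae (Eventually.of_forall fun x => ?_)
    have : Real.sqrt T ^ 2 = T := Real.sq_sqrt hT.le
    calc (Real.sqrt T * partialP b w' x) ^ 2 * ρ x = Real.sqrt T ^ 2 * ((partialP b w' x) ^ 2 * ρ x) := by ring
      _ = T * ((partialP b w' x) ^ 2 * ρ x) := by rw [this]
  rw [hsq b₀, hsq b₁]
  ring

end Pinned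

end Pencil

/-! ## Registered helper stub -/

open Pencil in
/-- **Registered sub-goal `stub_pencilOfGreenKubo_energy`** of the crux (this file's ticket): the energy identity (E₀) of a
forward Poisson solution paired with its nice field (= `Pencil.energy_identity`). [cite: CuneoEckmannHairerReyBellet2018, §3.1] -/
theorem stub_pencilOfGreenKubo_energy :
    ∀ (N : ℕ) (ω₂ lam β : ℝ), 0 < ω₂ → 0 ≤ lam → 0 ≤ β → ∀ (hN : 2 ≤ N) (T : ℝ), 0 < T → ∀ (γ : ℝ), 0 < γ → ∀ (F₀ F₁ v w : Literature.MathematicalPhysics.KineticTheory.HeatConduction.PhaseSpace N → ℝ), ContDiff ℝ ((⊤ : ℕ∞) : WithTop ℕ∞) F₀ → ContDiff ℝ ((⊤ : ℕ∞) : WithTop ℕ∞) F₁ → ∀ (A : ℝ), 0 ≤ A → (∀ y, |F₀ y| ≤ A * Real.exp ((Literature.MathematicalPhysics.KineticTheory.HeatConduction.pinnedChain ω₂ lam β γ).hamiltonian N y / (16 * T)) ∧ |Literature.MathematicalPhysics.KineticTheory.HeatConduction.partialP ⟨0, by omega⟩ F₀ y| ≤ A * Real.exp ((Literature.MathematicalPhysics.KineticTheory.HeatConduction.pinnedChain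 ω₂ lam β γ).hamiltonian N y / (16 * T)) ∧ |F₁ y| ≤ A * Real.exp ((Literature.MathematicalPhysics.KineticTheory.HeatConduction.pinnedChain ω₂ lam β γ).hamiltonian N y / (16 * T)) ∧ |Literature.MathematicalPhysics.KineticTheory.HeatConduction.partialP ⟨N - 1, by omega⟩ F₁ y| ≤ A * Real.exp ((Literature.MathematicalPhysics.KineticTheory.HeatConduction.pinnedChain ω₂ lam β γ).hamiltonian N y / (16 * T))) → (∀ x, v x = Real.sqrt T * (-Literature.MathematicalPhysics.KineticTheory.HeatConduction.partialP ⟨0, by omega⟩ F₀ x + x.2 ⟨0, by omega⟩ * F₀ x / T) + Real.sqrt T * (-Literature.MathematicalPhysics.KineticTheory.HeatConduction.partialP ⟨N - 1, by omega⟩ F₁ x + x.2 ⟨N - 1, by omega⟩ * F₁ x / T)) → ContDiff ℝ ((⊤ : ℕ∞) : WithTop ℕ∞) w → ∀ (K : ℝ), (∀ y, |w y| ≤ K * Real.exp ((Literature.MathematicalPhysics.KineticTheory.HeatConduction.pinnedChain ω₂ lam β γ).hamiltonian N y / (8 * T))) → (∀ x, (Literature.MathematicalPhysics.KineticTheory.HeatConduction.pinnedChain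 ω₂ lam β γ).generator N T T w x = -v x) → MeasureTheory.Integrable (fun x => (Literature.MathematicalPhysics.KineticTheory.HeatConduction.partialP ⟨0, by omega⟩ w x) ^ 2 * (Literature.MathematicalPhysics.KineticTheory.HeatConduction.pinnedChain ω₂ lam β γ).gibbsDensity N T x) ∧ MeasureTheory.Integrable (fun x => (Literature.MathematicalPhysics.KineticTheory.HeatConduction.partialP ⟨N - 1, by omega⟩ w x) ^ 2 * (Literature.MathematicalPhysics.KineticTheory.HeatConduction.pinnedChain ω₂ lam β γ).gibbsDensity N T x) ∧ (∫ x, F₀ x * (Real.sqrt T * Literature.MathematicalPhysics.KineticTheory.HeatConduction.partialP ⟨0, by omega⟩ w x) * (Literature.MathematicalPhysics.KineticTheory.HeatConduction.pinnedChain ω₂ lam β γ).gibbsDensity N T x) + ∫ x, F₁ x * (Real.sqrt T * Literature.MathematicalPhysics.KineticTheory.HeatConduction.partialP ⟨N - 1, by omega⟩ w x) * (Literature.MathematicalPhysics.KineticTheory.HeatConduction.pinnedChain ω₂ lam β γ).gibbsDensity N T x = γ * ((∫ x, (Real.sqrt T * Literature.MathematicalPhysics.KineticTheory.HeatConduction.partialP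 ⟨0, by omega⟩ w x) ^ 2 * (Literature.MathematicalPhysics.KineticTheory.HeatConduction.pinnedChain ω₂ lam β γ).gibbsDensity N T x) + ∫ x, (Real.sqrt T * Literature.MathematicalPhysics.KineticTheory.HeatConduction.partialP ⟨N - 1, by omega⟩ w x) ^ 2 * (Literature.MathematicalPhysics.KineticTheory.HeatConduction.pinnedChain ω₂ lam β γ).gibbsDensity N T x) :=
  fun _ _ _ _ hω hl hβ hN _ hT _ hγ _ _ _ _ hF₀ hF₁ _ hA hb hv hw _ hwb hLw =>
    energy_identity hω hl hβ hN hT hγ hF₀ hF₁ hA hb hv hw hwb hLw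

end Summit.AtomisticToContinuum.FouriersLaw.Theorems.ContactStieltjesMeasure.CayleyPencil

end
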